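import Mathlib
import Summits.ValiantsHypothesis.ValiantsHypothesis.Theorems.BarrierLeverPartitionMinorsHitByVPHiddenStatesSecondShellExchange
import Summits.ValiantsHypothesis.ValiantsHypothesis.Theorems.BarrierLeverPartitionMinorsHitByVPHiddenStatesSecondShellChainIdentity
import Summits.ValiantsHypothesis.ValiantsHypothesis.Theorems.BarrierLeverPartitionMinorsHitByVPHiddenStatesSecondShellChainFourColumn

/-!
# Route BarrierLever — item `PartitionMinorsHitByVP` (stmt-ValiantsHypothesis-19717), line `hidden-states`:
# ★ THE FOUR-MOVER CHAIN LEMMA, SHARP FORM — rows demanded monomial by monomial (degenerate chains allowed)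

Helper file (`--supports stmt-ValiantsHypothesis-19717`; cell valiant-natproofs, 𝒟-side door (c), registered line
`Cruxes/PartitionMinorsHitByVP/Lines/hidden_states.lean` v8; prover seat val-np-p6 gen 18).  Closes NO item; definition-free.
Same statement and proof as `…SecondShellChainFour.det_eq_zero_of_chain₄` except that the top-degree rows `Z ∪ {a,b,d}`,
`Z ∪ {a,e,d}`, `Z ∪ {a,d,d'}`, `Z ∪ {b,d,d'}`, `Z ∪ {e,d,d'}`, `Z ∪ {d,d',d''}` are demanded only when the relevant MONOMIAL of
their coefficient can be nonzero — in particular only when `σ₂ = w c b ≠ 0` for the monomials carrying `σ₂`.  This admits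
DEGENERATE chains (`σ₂ = 0`: two disjoint two-chains `b → a`, `e → c`), i.e. the doubly-inert second-shell classes.
HONEST LABEL: conjecture-column toolkit (second shell, every `t, h`); 19717 stays OPEN; nothing on crux 14610 or VP ≠ VNP.
-/

set_option linter.dupNamespace false

namespace Summit.ValiantsHypothesis.ValiantsHypothesis.Theorems.BarrierLever.HiddenStates

open Finset

noncomputable section

namespace SecondShell

variable {α : Type} [Fintype α] [DecidableEq α]

/-! ## ★ The four-mover chain lemma -/

set_option maxRecDepth 8192 in
set_option maxHeartbeats 800000 in
/-- ★ **THE FOUR-MOVER CHAIN LEMMA (sharp form).**  For ANY table `w`: if the start row `rows i₀ = Z ∪ {a,b,c,e}` has unit rows on `Z`, its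
four movers form the chain `e → c → b → a`, every exit read by a mover has a unit row, the columns have size `≤ |Z| + 3`, and the
rows listed in the module docstring are present among the other rows, then the determinant vanishes. -/
theorem det_eq_zero_of_chain₄' (w : α → α → ℂ) {r : ℕ} (rows cols : Fin r → Finset α) (i₀ : Fin r)
    (Z : Finset α) {a b c e : α} (hab : a ≠ b) (hac : a ≠ c) (hae : a ≠ e) (hbc : b ≠ c) (hbe : b ≠ e) (hce : c ≠ e)
    (haZ : a ∉ Z) (hbZ : b ∉ Z) (hcZ : c ∉ Z) (heZ : e ∉ Z)
    (hZ : ∀ z ∈ Z, ∀ q, w z q = if q = z then 1 else 0)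
    (haa : w a a = 1) (hab₀ : w a b = 0) (hac₀ : w a c = 0) (hae₀ : w a e = 0)
    (hbb : w b b = 1) (hbc₀ : w b c = 0) (hbe₀ : w b e = 0) (hcc : w c c = 1) (hca₀ : w c a = 0) (hce₀ : w c e = 0)
    (hee : w e e = 1) (hea₀ : w e a = 0) (heb₀ : w e b = 0)
    (hD : ∀ d, d ∉ Z → d ∉ ({a, b, c, e} : Finset α) → (w a d ≠ 0 ∨ w b d ≠ 0 ∨ w c d ≠ 0 ∨ w e d ≠ 0) →
      ∀ q, w d q = if q = d then 1 else 0)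
    (hrow : rows i₀ = insert a (insert b (insert c (insert e Z))))
    (hcol : ∀ kk, (cols kk).card ≤ Z.card + 3)
    (hlow : ∀ T : Finset α, Disjoint T Z → (T.card ≤ 2 ∨ (T ⊆ ({a, b, c, e} : Finset α) ∧ T.card ≤ 3)) →
      (∀ x ∈ T, x ∉ ({a, b, c, e} : Finset α) → (w a x ≠ 0 ∨ w b x ≠ 0 ∨ w c x ≠ 0 ∨ w e x ≠ 0)) →
      ∃ i, i ≠ i₀ ∧ rows i = T ∪ Z)
    (hTab : ∀ d, d ∉ Z → d ∉ ({a, b, c, e} : Finset α) → (w c d ≠ 0 ∨ (w c b ≠ 0 ∧ (w b d ≠ 0 ∨ w a d ≠ 0))) →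
      ∃ i, i ≠ i₀ ∧ rows i = {a, b, d} ∪ Z)
    (hTac : ∀ d, d ∉ Z → d ∉ ({a, b, c, e} : Finset α) → w b d ≠ 0 → w e d ≠ 0 → ∃ i, i ≠ i₀ ∧ rows i = {a, c, d} ∪ Z)
    (hTae : ∀ d, d ∉ Z → d ∉ ({a, b, c, e} : Finset α) → (w b d ≠ 0 ∨ (w a d ≠ 0 ∧ w c b ≠ 0)) →
      ∃ i, i ≠ i₀ ∧ rows i = {a, e, d} ∪ Z)
    (hTbc : ∀ d, d ∉ Z → d ∉ ({a, b, c, e} : Finset α) → w a d ≠ 0 → w e d ≠ 0 → ∃ i, i ≠ i₀ ∧ rows i = {b, c, d} ∪ Z)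
    (hTbe : ∀ d, d ∉ Z → d ∉ ({a, b, c, e} : Finset α) → w a d ≠ 0 → w c d ≠ 0 → ∃ i, i ≠ i₀ ∧ rows i = {b, e, d} ∪ Z)
    (hTce : ∀ d, d ∉ Z → d ∉ ({a, b, c, e} : Finset α) → w a d ≠ 0 → ∃ i, i ≠ i₀ ∧ rows i = {c, e, d} ∪ Z)
    (hTa : ∀ d d', d ≠ d' → d ∉ Z → d' ∉ Z → d ∉ ({a, b, c, e} : Finset α) → d' ∉ ({a, b, c, e} : Finset α) →
      w c b ≠ 0 → w b d ≠ 0 → (w b d' ≠ 0 ∨ w a d' ≠ 0) → ∃ i, i ≠ i₀ ∧ rows i = {a, d, d'} ∪ Z)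
    (hTb : ∀ d d', d ≠ d' → d ∉ Z → d' ∉ Z → d ∉ ({a, b, c, e} : Finset α) → d' ∉ ({a, b, c, e} : Finset α) →
      w c b ≠ 0 → w a d ≠ 0 → w a d' ≠ 0 → ∃ i, i ≠ i₀ ∧ rows i = {b, d, d'} ∪ Z)
    (hTe : ∀ d d', d ≠ d' → d ∉ Z → d' ∉ Z → d ∉ ({a, b, c, e} : Finset α) → d' ∉ ({a, b, c, e} : Finset α) →
      w c b ≠ 0 → w a d ≠ 0 → w a d' ≠ 0 → ∃ i, i ≠ i₀ ∧ rows i = {e, d, d'} ∪ Z)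
    (hT3 : ∀ d d' d'', d ≠ d' → d ≠ d'' → d' ≠ d'' → d ∉ Z → d' ∉ Z → d'' ∉ Z →
      d ∉ ({a, b, c, e} : Finset α) → d' ∉ ({a, b, c, e} : Finset α) → d'' ∉ ({a, b, c, e} : Finset α) →
      w c b ≠ 0 → w b d ≠ 0 → w a d' ≠ 0 → w a d'' ≠ 0 → ∃ i, i ≠ i₀ ∧ rows i = {d, d', d''} ∪ Z) :
    (mat w rows cols).det = 0 := by
  classical
  set Mx : Matrix (Fin r) (Fin r) ℂ := mat w rows cols with hMx
  obtain ⟨M, hMdef⟩ : ∃ M : Finset α, M = ({a, b, c, e} : Finset α) := ⟨_, rfl⟩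
  have hMiff : ∀ x, x ∈ M ↔ x = a ∨ x = b ∨ x = c ∨ x = e := by
    intro x; rw [hMdef]; simp only [Finset.mem_insert, Finset.mem_singleton]
  obtain ⟨haM, hbM, hcM, heM⟩ : a ∈ M ∧ b ∈ M ∧ c ∈ M ∧ e ∈ M := by rw [hMdef]; simp
  have hMZ : Disjoint M Z := by
    rw [Finset.disjoint_left]; intro x hx
    rcases (hMiff x).1 hx with rfl | rfl | rfl | rfl <;> assumption
  obtain ⟨D, hDdef⟩ : ∃ D : Finset α, D = (Finset.univ \ (M ∪ Z)).filter
      (fun d => w a d ≠ 0 ∨ w b d ≠ 0 ∨ w c d ≠ 0 ∨ w e d ≠ 0) := ⟨_, rfl⟩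
  have hDiff : ∀ d, d ∈ D ↔ (d ∉ ({a, b, c, e} : Finset α) ∧ d ∉ Z) ∧ (w a d ≠ 0 ∨ w b d ≠ 0 ∨ w c d ≠ 0 ∨ w e d ≠ 0) := by
    intro d; rw [hDdef, Finset.mem_filter, Finset.mem_sdiff, Finset.mem_union, not_or, hMdef]
    simp only [Finset.mem_univ, true_and]
  have hDm : ∀ d ∈ D, d ∉ M ∧ d ∉ Z ∧ d ≠ a ∧ d ≠ b ∧ d ≠ c ∧ d ≠ e ∧ (w a d ≠ 0 ∨ w b d ≠ 0 ∨ w c d ≠ 0 ∨ w e d ≠ 0) := by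
    intro d hd
    obtain ⟨⟨h1, h2⟩, h3⟩ := (hDiff d).1 hd
    rw [← hMdef] at h1
    refine ⟨h1, h2, ?_, ?_, ?_, ?_, h3⟩ <;> (rintro rfl) <;> [exact h1 haM; exact h1 hbM; exact h1 hcM; exact h1 heM]
  have hDM : ∀ d ∈ D, d ∉ ({a, b, c, e} : Finset α) := fun d hd => hMdef ▸ (hDm d hd).1
  let ρ : Finset α → Fin r := fun S => if h : ∃ i, i ≠ i₀ ∧ rows i = S ∪ Z then Classical.choose h else i₀
  have hρ : ∀ S, (∃ i, i ≠ i₀ ∧ rows i = S ∪ Z) → ρ S ≠ i₀ ∧ rows (ρ S) = S ∪ Z := by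
    intro S h; simp only [ρ, dif_pos h]; exact Classical.choose_spec h
  set V : Submodule ℂ (Fin r → ℂ) := Submodule.span ℂ (Mx '' {i | i ≠ i₀}) with hV
  have hsp : ∀ (S : Finset α) (cf : ℂ), (cf ≠ 0 → ∃ i, i ≠ i₀ ∧ rows i = S ∪ Z) → cf • Mx (ρ S) ∈ V := by
    intro S cf h
    by_cases hc : cf = 0
    · rw [hc, zero_smul]; exact V.zero_mem
    · exact V.smul_mem _ (Submodule.subset_span ⟨ρ S, (hρ S (h hc)).1, rfl⟩)
  have sb1 : ∀ x, x ∈ M → ({x} : Finset α) ⊆ M := fun x hx => Finset.singleton_subset_iff.2 hx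
  have sb2 : ∀ x y, x ∈ M → y ∈ M → ({x, y} : Finset α) ⊆ M := fun x y hx hy => Finset.insert_subset hx (sb1 y hy)
  have sb3 : ∀ x y u, x ∈ M → y ∈ M → u ∈ M → ({x, y, u} : Finset α) ⊆ M :=
    fun x y u hx hy hu => Finset.insert_subset hx (sb2 y u hy hu)
  have okM : ∀ S : Finset α, S ⊆ M → S.card ≤ 3 → ∃ i, i ≠ i₀ ∧ rows i = S ∪ Z := by
    intro S hS hS3
    refine hlow S (Finset.disjoint_of_subset_left hS hMZ) (Or.inr ⟨hMdef ▸ hS, hS3⟩) fun x hx hxM => ?_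
    exact absurd (hMdef ▸ hS hx) hxM
  have okD : ∀ S : Finset α, S.card ≤ 2 → (∀ x ∈ S, x ∈ M ∨ x ∈ D) → ∃ i, i ≠ i₀ ∧ rows i = S ∪ Z := by
    intro S hS hx
    refine hlow S ?_ (Or.inl hS) fun x hxS hxM => ?_
    · rw [Finset.disjoint_left]; intro x hxS
      rcases hx x hxS with h | h
      · exact Finset.disjoint_left.1 hMZ h
      · exact (hDm x h).2.1
    · rcases hx x hxS with h | h
      · exact absurd (hMdef ▸ h) hxM
      · exact (hDm x h).2.2.2.2.2.2
  have ok1 : ∀ d ∈ D, ∃ i, i ≠ i₀ ∧ rows i = {d} ∪ Z := fun d hd =>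
    okD {d} (by simp) fun x hx => by rw [Finset.mem_singleton] at hx; subst hx; exact Or.inr hd
  have okyd : ∀ y, y ∈ M → ∀ d ∈ D, ∃ i, i ≠ i₀ ∧ rows i = {y, d} ∪ Z := by
    intro y hy d hd
    refine okD {y, d} (Finset.card_insert_le _ _ |>.trans (by simp)) fun x hx => ?_
    rw [Finset.mem_insert, Finset.mem_singleton] at hx
    rcases hx with rfl | rfl
    · exact Or.inl hy
    · exact Or.inr hd
  have okdd : ∀ d ∈ D, ∀ d' ∈ D, d ≠ d' → ∃ i, i ≠ i₀ ∧ rows i = {d, d'} ∪ Z := by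
    intro d hd d' hd' hne
    refine okD {d, d'} (by rw [Finset.card_pair hne]) fun x hx => ?_
    rw [Finset.mem_insert, Finset.mem_singleton] at hx
    rcases hx with rfl | rfl
    · exact Or.inr hd
    · exact Or.inr hd'
  have okab : ∀ d ∈ D, (w c d * w e d - w e c * w c d - w c b * w e c * w b d - w b a * w c b * w e c * w a d) ≠ 0 → ∃ i, i ≠ i₀ ∧ rows i = {a, b, d} ∪ Z := by
    intro d hd hcf
    refine hTab d (hDm d hd).2.1 (hDM d hd) ?_
    by_contra hcon; push Not at hcon; apply hcf; rw [hcon.1]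
    by_cases hs : w c b = 0
    · rw [hs]; ring
    · obtain ⟨h1, h2⟩ := hcon.2 hs; rw [h1, h2]; ring
  have okac : ∀ d ∈ D, (w b d * w e d) ≠ 0 → ∃ i, i ≠ i₀ ∧ rows i = {a, c, d} ∪ Z := fun d hd hcf =>
    hTac d (hDm d hd).2.1 (hDM d hd) (left_ne_zero_of_mul hcf) (right_ne_zero_of_mul hcf)
  have okae : ∀ d ∈ D, (w b d * w c d - w c b * w b d - w b a * w c b * w a d) ≠ 0 → ∃ i, i ≠ i₀ ∧ rows i = {a, e, d} ∪ Z := by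
    intro d hd hcf
    refine hTae d (hDm d hd).2.1 (hDM d hd) ?_
    by_contra hcon; push Not at hcon; apply hcf; rw [hcon.1]
    by_cases ha : w a d = 0
    · rw [ha]; ring
    · rw [hcon.2 ha]; ring
  have okbc : ∀ d ∈ D, (w a d * w e d) ≠ 0 → ∃ i, i ≠ i₀ ∧ rows i = {b, c, d} ∪ Z := fun d hd hcf =>
    hTbc d (hDm d hd).2.1 (hDM d hd) (left_ne_zero_of_mul hcf) (right_ne_zero_of_mul hcf)
  have okbe : ∀ d ∈ D, (w a d * w c d) ≠ 0 → ∃ i, i ≠ i₀ ∧ rows i = {b, e, d} ∪ Z := fun d hd hcf =>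
    hTbe d (hDm d hd).2.1 (hDM d hd) (left_ne_zero_of_mul hcf) (right_ne_zero_of_mul hcf)
  have okce : ∀ d ∈ D, (w a d * w b d - w b a * w a d) ≠ 0 → ∃ i, i ≠ i₀ ∧ rows i = {c, e, d} ∪ Z := by
    intro d hd hcf
    refine hTce d (hDm d hd).2.1 (hDM d hd) ?_
    intro h0; apply hcf; rw [h0]; ring
  have ok2a : ∀ d ∈ D, ∀ d' ∈ D.erase d, (w c b * w e c * w b d * w b d' + 2 * w b a * w c b * w e c * w b d * w a d') ≠ 0 →
      ∃ i, i ≠ i₀ ∧ rows i = {a, d, d'} ∪ Z := by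
    intro d hd d' hd' hcf
    obtain ⟨hne, hd'D⟩ := Finset.mem_erase.1 hd'
    refine hTa d d' (Ne.symm hne) (hDm d hd).2.1 (hDm d' hd'D).2.1 (hDM d hd) (hDM d' hd'D) ?_ ?_ ?_
    · intro h0; apply hcf; rw [h0]; ring
    · intro h0; apply hcf; rw [h0]; ring
    · by_contra hcon; push Not at hcon; apply hcf; rw [hcon.1, hcon.2]; ring
  have ok2b : ∀ d ∈ D, ∀ d' ∈ D.erase d, (w b a * w c b * w e c * w a d * w a d') ≠ 0 → ∃ i, i ≠ i₀ ∧ rows i = {b, d, d'} ∪ Z := by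
    intro d hd d' hd' hcf
    obtain ⟨hne, hd'D⟩ := Finset.mem_erase.1 hd'
    refine hTb d d' (Ne.symm hne) (hDm d hd).2.1 (hDm d' hd'D).2.1 (hDM d hd) (hDM d' hd'D) ?_ ?_ ?_ <;>
      (intro h0; apply hcf; rw [h0]; ring)
  have ok2e : ∀ d ∈ D, ∀ d' ∈ D.erase d, (w b a * w c b * w a d * w a d') ≠ 0 → ∃ i, i ≠ i₀ ∧ rows i = {e, d, d'} ∪ Z := by
    intro d hd d' hd' hcf
    obtain ⟨hne, hd'D⟩ := Finset.mem_erase.1 hd'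
    refine hTe d d' (Ne.symm hne) (hDm d hd).2.1 (hDm d' hd'D).2.1 (hDM d hd) (hDM d' hd'D) ?_ ?_ ?_ <;>
      (intro h0; apply hcf; rw [h0]; ring)
  have ok3 : ∀ d ∈ D, ∀ d' ∈ D.erase d, ∀ d'' ∈ (D.erase d).erase d', (-(2 * w b a * w c b * w e c * w b d * w a d' * w a d'')) ≠ 0 →
      ∃ i, i ≠ i₀ ∧ rows i = {d, d', d''} ∪ Z := by
    intro d hd d' hd' d'' hd'' hcf
    obtain ⟨hne, hd'D⟩ := Finset.mem_erase.1 hd'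
    obtain ⟨hne', hd''1⟩ := Finset.mem_erase.1 hd''
    obtain ⟨hne'', hd''D⟩ := Finset.mem_erase.1 hd''1
    refine hT3 d d' d'' (Ne.symm hne) (Ne.symm hne'') (Ne.symm hne') (hDm d hd).2.1 (hDm d' hd'D).2.1 (hDm d'' hd''D).2.1
      (hDM d hd) (hDM d' hd'D) (hDM d'' hd''D) ?_ ?_ ?_ ?_ <;> (intro h0; apply hcf; rw [h0]; ring)
  suffices hmain : ∃ v ∈ V, ∀ kk, Mx i₀ kk = v kk by
    obtain ⟨v, hv, hvk⟩ := hmain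
    apply det_eq_zero_of_row_mem_span Mx i₀
    rw [show Mx i₀ = v from funext hvk]
    exact hv
  refine ⟨
          ((-((∑ z ∈ Z, w a z) * (∑ z ∈ Z, w b z) * (∑ z ∈ Z, w c z) * (∑ z ∈ Z, w e z))
                - w e c * (∑ z ∈ Z, w a z) * (∑ z ∈ Z, w b z) * (∑ z ∈ Z, w c z)
                - w c b * (∑ z ∈ Z, w a z) * (∑ z ∈ Z, w b z) * (∑ z ∈ Z, w e z)
                - w c b * w e c * (∑ z ∈ Z, w a z) * (∑ z ∈ Z, w b z)
                - w b a * (∑ z ∈ Z, w a z) * (∑ z ∈ Z, w c z) * (∑ z ∈ Z, w e z)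
                - w b a * w e c * (∑ z ∈ Z, w a z) * (∑ z ∈ Z, w c z)
                - w b a * w c b * (∑ z ∈ Z, w a z) * (∑ z ∈ Z, w e z) - w b a * w c b * w e c * (∑ z ∈ Z, w a z)) • Mx (ρ ∅)
            + ((∑ z ∈ Z, w b z) * (∑ z ∈ Z, w c z) * (∑ z ∈ Z, w e z) + w e c * (∑ z ∈ Z, w b z) * (∑ z ∈ Z, w c z)
                + w c b * (∑ z ∈ Z, w b z) * (∑ z ∈ Z, w e z) + w c b * w e c * (∑ z ∈ Z, w b z)
                + w b a * (∑ z ∈ Z, w c z) * (∑ z ∈ Z, w e z) + w b a * w e c * (∑ z ∈ Z, w c z)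
                + w b a * w c b * (∑ z ∈ Z, w e z) + w b a * w c b * w e c) • Mx (ρ {a})
            + ((∑ z ∈ Z, w a z) * (∑ z ∈ Z, w c z) * (∑ z ∈ Z, w e z) + w e c * (∑ z ∈ Z, w a z) * (∑ z ∈ Z, w c z)
                + w c b * (∑ z ∈ Z, w a z) * (∑ z ∈ Z, w e z) + w c b * w e c * (∑ z ∈ Z, w a z)) • Mx (ρ {b})
            + ((∑ z ∈ Z, w a z) * (∑ z ∈ Z, w b z) * (∑ z ∈ Z, w e z) + w e c * (∑ z ∈ Z, w a z) * (∑ z ∈ Z, w b z)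
                + w b a * (∑ z ∈ Z, w a z) * (∑ z ∈ Z, w e z) + w b a * w e c * (∑ z ∈ Z, w a z)) • Mx (ρ {c})
            + ((∑ z ∈ Z, w a z) * (∑ z ∈ Z, w b z) * (∑ z ∈ Z, w c z) + w c b * (∑ z ∈ Z, w a z) * (∑ z ∈ Z, w b z)
                + w b a * (∑ z ∈ Z, w a z) * (∑ z ∈ Z, w c z) + w b a * w c b * (∑ z ∈ Z, w a z)) • Mx (ρ {e})
            + (-((∑ z ∈ Z, w c z) * (∑ z ∈ Z, w e z)) - w e c * (∑ z ∈ Z, w c z) - w c b * (∑ z ∈ Z, w e z)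
                - w c b * w e c) • Mx (ρ {a, b})
            + (-((∑ z ∈ Z, w b z) * (∑ z ∈ Z, w e z)) - w e c * (∑ z ∈ Z, w b z) - w b a * (∑ z ∈ Z, w e z)
                - w b a * w e c) • Mx (ρ {a, c})
            + (-((∑ z ∈ Z, w b z) * (∑ z ∈ Z, w c z)) - w c b * (∑ z ∈ Z, w b z) - w b a * (∑ z ∈ Z, w c z)
                - w b a * w c b) • Mx (ρ {a, e})
            + (-((∑ z ∈ Z, w a z) * (∑ z ∈ Z, w e z)) - w e c * (∑ z ∈ Z, w a z)) • Mx (ρ {b, c})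
            + (-((∑ z ∈ Z, w a z) * (∑ z ∈ Z, w c z)) - w c b * (∑ z ∈ Z, w a z)) • Mx (ρ {b, e})
            + (-((∑ z ∈ Z, w a z) * (∑ z ∈ Z, w b z)) - w b a * (∑ z ∈ Z, w a z)) • Mx (ρ {c, e})
            + ((∑ z ∈ Z, w e z) + w e c) • Mx (ρ {a, b, c})
            + ((∑ z ∈ Z, w c z) + w c b) • Mx (ρ {a, b, e})
            + ((∑ z ∈ Z, w b z) + w b a) • Mx (ρ {a, c, e})
            + ((∑ z ∈ Z, w a z)) • Mx (ρ {b, c, e}))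
          + ∑ d ∈ D, ((3 * w a d * w b d * w c d * w e d + 2 * (∑ z ∈ Z, w e z) * w a d * w b d * w c d
                + 2 * (∑ z ∈ Z, w c z) * w a d * w b d * w e d + (∑ z ∈ Z, w c z) * (∑ z ∈ Z, w e z) * w a d * w b d
                + 2 * (∑ z ∈ Z, w b z) * w a d * w c d * w e d + (∑ z ∈ Z, w b z) * (∑ z ∈ Z, w e z) * w a d * w c d
                + (∑ z ∈ Z, w b z) * (∑ z ∈ Z, w c z) * w a d * w e d + 2 * (∑ z ∈ Z, w a z) * w b d * w c d * w e d
                + (∑ z ∈ Z, w a z) * (∑ z ∈ Z, w e z) * w b d * w c d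
                + (∑ z ∈ Z, w a z) * (∑ z ∈ Z, w c z) * w b d * w e d
                + (∑ z ∈ Z, w a z) * (∑ z ∈ Z, w b z) * w c d * w e d + w e c * w a d * w b d * w c d
                + w e c * (∑ z ∈ Z, w c z) * w a d * w b d - w e c * (∑ z ∈ Z, w a z) * (∑ z ∈ Z, w b z) * w c d
                + w c b * w a d * w b d * w e d + w c b * (∑ z ∈ Z, w b z) * w a d * w e d
                - w c b * (∑ z ∈ Z, w a z) * (∑ z ∈ Z, w e z) * w b d - w c b * w e c * w a d * w b d ^ 2
                - w c b * w e c * (∑ z ∈ Z, w b z) * w a d * w b d - w c b * w e c * (∑ z ∈ Z, w a z) * w b d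
                - w c b * w e c * (∑ z ∈ Z, w a z) * w b d ^ 2
                - w c b * w e c * (∑ z ∈ Z, w a z) * (∑ z ∈ Z, w b z) * w b d + w b a * w a d * w c d * w e d
                - w b a * (∑ z ∈ Z, w c z) * (∑ z ∈ Z, w e z) * w a d + w b a * (∑ z ∈ Z, w a z) * w c d * w e d
                - w b a * w e c * w a d * w c d - w b a * w e c * (∑ z ∈ Z, w c z) * w a d
                - w b a * w e c * (∑ z ∈ Z, w a z) * w c d - w b a * w c b * w a d ^ 2 * w e d
                - w b a * w c b * (∑ z ∈ Z, w e z) * w a d - w b a * w c b * (∑ z ∈ Z, w e z) * w a d ^ 2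
                - w b a * w c b * (∑ z ∈ Z, w a z) * w a d * w e d
                - w b a * w c b * (∑ z ∈ Z, w a z) * (∑ z ∈ Z, w e z) * w a d - w b a * w c b * w e c * w a d
                - w b a * w c b * w e c * w a d * w b d - w b a * w c b * w e c * w a d ^ 2
                - w b a * w c b * w e c * w a d ^ 2 * w b d - w b a * w c b * w e c * (∑ z ∈ Z, w b z) * w a d ^ 2
                - w b a * w c b * w e c * (∑ z ∈ Z, w a z) * w b d
                - w b a * w c b * w e c * (∑ z ∈ Z, w a z) * w a d
                - w b a * w c b * w e c * (∑ z ∈ Z, w a z) * w a d * w b d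
                - w b a * w c b * w e c * (∑ z ∈ Z, w a z) * (∑ z ∈ Z, w b z) * w a d
                - w b a ^ 2 * w c b * w e c * w a d ^ 2 - w b a ^ 2 * w c b * w e c * (∑ z ∈ Z, w a z) * w a d) • Mx (ρ {d})
            + (-(2 * w b d * w c d * w e d) - (∑ z ∈ Z, w e z) * w b d * w c d - (∑ z ∈ Z, w c z) * w b d * w e d
                - (∑ z ∈ Z, w b z) * w c d * w e d + w e c * (∑ z ∈ Z, w b z) * w c d
                + w c b * (∑ z ∈ Z, w e z) * w b d + w c b * w e c * w b d + w c b * w e c * w b d ^ 2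
                + w c b * w e c * (∑ z ∈ Z, w b z) * w b d - w b a * w c d * w e d + w b a * w e c * w c d
                + w b a * w c b * w a d * w e d + w b a * w c b * (∑ z ∈ Z, w e z) * w a d
                + w b a * w c b * w e c * w b d + w b a * w c b * w e c * w a d
                + w b a * w c b * w e c * w a d * w b d + w b a * w c b * w e c * (∑ z ∈ Z, w b z) * w a d
                + w b a ^ 2 * w c b * w e c * w a d) • Mx (ρ {a, d})
            + (-(2 * w a d * w c d * w e d) - (∑ z ∈ Z, w e z) * w a d * w c d - (∑ z ∈ Z, w c z) * w a d * w e d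
                - (∑ z ∈ Z, w a z) * w c d * w e d + w e c * (∑ z ∈ Z, w a z) * w c d - w c b * w a d * w e d
                + w c b * w e c * w a d * w b d + w c b * w e c * (∑ z ∈ Z, w a z) * w b d
                + w b a * w c b * w e c * w a d ^ 2 + w b a * w c b * w e c * (∑ z ∈ Z, w a z) * w a d) • Mx (ρ {b, d})
            + (-(2 * w a d * w b d * w e d) - (∑ z ∈ Z, w e z) * w a d * w b d - (∑ z ∈ Z, w b z) * w a d * w e d
                - (∑ z ∈ Z, w a z) * w b d * w e d - w e c * w a d * w b d + w b a * (∑ z ∈ Z, w e z) * w a d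
                + w b a * w e c * w a d) • Mx (ρ {c, d})
            + (-(2 * w a d * w b d * w c d) - (∑ z ∈ Z, w c z) * w a d * w b d - (∑ z ∈ Z, w b z) * w a d * w c d
                - (∑ z ∈ Z, w a z) * w b d * w c d + w c b * (∑ z ∈ Z, w a z) * w b d
                + w b a * (∑ z ∈ Z, w c z) * w a d + w b a * w c b * w a d + w b a * w c b * w a d ^ 2
                + w b a * w c b * (∑ z ∈ Z, w a z) * w a d) • Mx (ρ {e, d})
            + (w c d * w e d - w e c * w c d - w c b * w e c * w b d - w b a * w c b * w e c * w a d) • Mx (ρ {a, b, d})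
            + (w b d * w e d) • Mx (ρ {a, c, d})
            + (w b d * w c d - w c b * w b d - w b a * w c b * w a d) • Mx (ρ {a, e, d})
            + (w a d * w e d) • Mx (ρ {b, c, d})
            + (w a d * w c d) • Mx (ρ {b, e, d})
            + (w a d * w b d - w b a * w a d) • Mx (ρ {c, e, d}))
          + ∑ d ∈ D, ∑ d' ∈ D.erase d, ((-(w c d * w e d * w a d' * w b d') - w b d * w e d * w a d' * w c d'
                - w b d * w c d * w a d' * w e d' + w e c * w c d * w a d' * w b d'
                + w c b * w b d * w a d' * w e d' - w c b * w e c * w b d * w a d' * w b d'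
                - w c b * w e c * (∑ z ∈ Z, w a z) * w b d * w b d' + w b a * w c d * w e d * w a d'
                - w b a * w e c * w c d * w a d' - w b a * w c b * w a d * w a d' * w e d'
                - w b a * w c b * (∑ z ∈ Z, w e z) * w a d * w a d' - w b a * w c b * w e c * w b d * w a d'
                - 2 * w b a * w c b * w e c * w b d * w a d' ^ 2 - w b a * w c b * w e c * w a d * w a d'
                - 3 * w b a * w c b * w e c * w a d * w a d' * w b d'
                - w b a * w c b * w e c * (∑ z ∈ Z, w b z) * w a d * w a d'
                - 2 * w b a * w c b * w e c * (∑ z ∈ Z, w a z) * w b d * w a d'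
                - w b a ^ 2 * w c b * w e c * w a d * w a d') • Mx (ρ {d, d'})
            + (w c b * w e c * w b d * w b d' + 2 * w b a * w c b * w e c * w b d * w a d') • Mx (ρ {a, d, d'})
            + (w b a * w c b * w e c * w a d * w a d') • Mx (ρ {b, d, d'})
            + (w b a * w c b * w a d * w a d') • Mx (ρ {e, d, d'}))
          + ∑ d ∈ D, ∑ d' ∈ D.erase d, ∑ d'' ∈ (D.erase d).erase d', (-(2 * w b a * w c b * w e c * w b d * w a d' * w a d'')) • Mx (ρ {d, d', d''}), ?_, ?_⟩
  · refine V.add_mem (V.add_mem (V.add_mem ?_ (V.sum_mem fun d hd => ?_))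
      (V.sum_mem fun d hd => V.sum_mem fun d' hd' => ?_))
      (V.sum_mem fun d hd => V.sum_mem fun d' hd' => V.sum_mem fun d'' hd'' => hsp _ _ (ok3 d hd d' hd' d'' hd''))
    · have hM1 : ∀ (x : α) (cf : ℂ), x ∈ M → cf • Mx (ρ {x}) ∈ V := fun x cf hx => hsp {x} cf fun _ => okM {x} (sb1 x hx) (by simp)
      have hM2 : ∀ (x y : α) (cf : ℂ), x ∈ M → y ∈ M → cf • Mx (ρ {x, y}) ∈ V :=
        fun x y cf hx hy => hsp {x, y} cf fun _ => okM {x, y} (sb2 x y hx hy) (Finset.card_le_two.trans (by norm_num))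
      have hM3 : ∀ (x y u : α) (cf : ℂ), x ∈ M → y ∈ M → u ∈ M → cf • Mx (ρ {x, y, u}) ∈ V :=
        fun x y u cf hx hy hu => hsp {x, y, u} cf fun _ => okM {x, y, u} (sb3 x y u hx hy hu) Finset.card_le_three
      exact V.add_mem (V.add_mem (V.add_mem (V.add_mem (V.add_mem (V.add_mem (V.add_mem (V.add_mem (V.add_mem (V.add_mem
        (V.add_mem (V.add_mem (V.add_mem (V.add_mem (hsp ∅ _ fun _ => okM ∅ (Finset.empty_subset _) (by simp))
        (hM1 a _ haM)) (hM1 b _ hbM)) (hM1 c _ hcM)) (hM1 e _ heM)) (hM2 a b _ haM hbM)) (hM2 a c _ haM hcM)) (hM2 a e _ haM heM))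
        (hM2 b c _ hbM hcM)) (hM2 b e _ hbM heM)) (hM2 c e _ hcM heM)) (hM3 a b c _ haM hbM hcM)) (hM3 a b e _ haM hbM heM))
        (hM3 a c e _ haM hcM heM)) (hM3 b c e _ hbM hcM heM)
    · exact V.add_mem (V.add_mem (V.add_mem (V.add_mem (V.add_mem (V.add_mem (V.add_mem (V.add_mem (V.add_mem (V.add_mem
        (hsp _ _ fun _ => ok1 d hd) (hsp _ _ fun _ => okyd a haM d hd)) (hsp _ _ fun _ => okyd b hbM d hd))
        (hsp _ _ fun _ => okyd c hcM d hd)) (hsp _ _ fun _ => okyd e heM d hd)) (hsp _ _ (okab d hd)))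
        (hsp _ _ (okac d hd))) (hsp _ _ (okae d hd))) (hsp _ _ (okbc d hd))) (hsp _ _ (okbe d hd))) (hsp _ _ (okce d hd))
    · exact V.add_mem (V.add_mem (V.add_mem
        (hsp _ _ fun _ => okdd d hd d' (Finset.mem_erase.1 hd').2 (Ne.symm (Finset.mem_erase.1 hd').1))
        (hsp _ _ (ok2a d hd d' hd'))) (hsp _ _ (ok2b d hd d' hd'))) (hsp _ _ (ok2e d hd d' hd'))
  · intro kk
    set a₀ : ℂ := ∑ z ∈ Z, w a z with ha₀
    set b₀ : ℂ := ∑ z ∈ Z, w b z with hb₀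
    set c₀ : ℂ := ∑ z ∈ Z, w c z with hc₀
    set e₀ : ℂ := ∑ z ∈ Z, w e z with he₀
    simp only [Pi.add_apply, Finset.sum_apply, Pi.smul_apply, smul_eq_mul]
    set J : Finset α := cols kk with hJ
    set Y : α → ℂ := fun u => ∑ q ∈ J, w u q with hY
    set Φ : ℂ := ∏ z ∈ Z, Y z with hΦ
    have hval : ∀ S : Finset α, Disjoint S Z → (∃ i, i ≠ i₀ ∧ rows i = S ∪ Z) → Mx (ρ S) kk = (∏ u ∈ S, Y u) * Φ := by
      intro S hS h
      simp only [hMx, mat, Matrix.of_apply]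
      rw [(hρ S h).2, Finset.prod_union hS]
    have hT : ∀ (S : Finset α) (cf : ℂ), Disjoint S Z → (cf ≠ 0 → ∃ i, i ≠ i₀ ∧ rows i = S ∪ Z) →
        cf * Mx (ρ S) kk = cf * ((∏ u ∈ S, Y u) * Φ) := by
      intro S cf hS h
      by_cases hc : cf = 0
      · rw [hc, zero_mul, zero_mul]
      · rw [hval S hS (h hc)]
    have hval₀ : Mx i₀ kk = Y a * Y b * Y c * Y e * Φ := by
      simp only [hMx, mat, Matrix.of_apply]
      rw [hrow, Finset.prod_insert (by simp [hab, hac, hae, haZ]), Finset.prod_insert (by simp [hbc, hbe, hbZ]),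
        Finset.prod_insert (by simp [hce, hcZ]), Finset.prod_insert heZ]
      simp only [hY, hΦ]; ring
    have dM : ∀ S : Finset α, S ⊆ M → Disjoint S Z := fun S hS => Finset.disjoint_of_subset_left hS hMZ
    have d1 : ∀ x, x ∈ M ∨ x ∈ D → x ∉ Z := by
      rintro x (h | h)
      · exact Finset.disjoint_left.1 hMZ h
      · exact (hDm x h).2.1
    have dS1 : ∀ x, x ∈ M ∨ x ∈ D → Disjoint ({x} : Finset α) Z := fun x hx => Finset.disjoint_singleton_left.2 (d1 x hx)
    have dS2 : ∀ x y, x ∈ M ∨ x ∈ D → y ∈ M ∨ y ∈ D → Disjoint ({x, y} : Finset α) Z := fun x y hx hy => by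
      rw [Finset.disjoint_insert_left]; exact ⟨d1 x hx, dS1 y hy⟩
    have dS3 : ∀ x y u, x ∈ M ∨ x ∈ D → y ∈ M ∨ y ∈ D → u ∈ M ∨ u ∈ D → Disjoint ({x, y, u} : Finset α) Z :=
      fun x y u hx hy hu => by rw [Finset.disjoint_insert_left]; exact ⟨d1 x hx, dS2 y u hy hu⟩
    have hp2 : ∀ x y, x ≠ y → ∏ u ∈ ({x, y} : Finset α), Y u = Y x * Y y := fun x y h => Finset.prod_pair h
    have hp3 : ∀ x y u, x ≠ y → x ≠ u → y ≠ u → ∏ v ∈ ({x, y, u} : Finset α), Y v = Y x * Y y * Y u := by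
      intro x y u h1 h2 h3
      rw [Finset.prod_insert (by simp [h1, h2]), Finset.prod_pair h3]; ring
    have hTM : ∀ (S : Finset α), S ⊆ M → S.card ≤ 3 → ∀ cf : ℂ, cf * Mx (ρ S) kk = cf * ((∏ u ∈ S, Y u) * Φ) :=
      fun S hS hS3 cf => hT S cf (dM S hS) fun _ => okM S hS hS3
    have c2 : ∀ x y : α, ({x, y} : Finset α).card ≤ 3 := fun x y => Finset.card_le_two.trans (by norm_num)
    rw [hval₀, hTM ∅ (Finset.empty_subset _) (by simp), hTM {a} (sb1 a haM) (by simp), hTM {b} (sb1 b hbM) (by simp),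
      hTM {c} (sb1 c hcM) (by simp), hTM {e} (sb1 e heM) (by simp), hTM {a, b} (sb2 a b haM hbM) (c2 a b),
      hTM {a, c} (sb2 a c haM hcM) (c2 a c), hTM {a, e} (sb2 a e haM heM) (c2 a e), hTM {b, c} (sb2 b c hbM hcM) (c2 b c),
      hTM {b, e} (sb2 b e hbM heM) (c2 b e), hTM {c, e} (sb2 c e hcM heM) (c2 c e),
      hTM {a, b, c} (sb3 a b c haM hbM hcM) Finset.card_le_three, hTM {a, b, e} (sb3 a b e haM hbM heM) Finset.card_le_three,
      hTM {a, c, e} (sb3 a c e haM hcM heM) Finset.card_le_three, hTM {b, c, e} (sb3 b c e hbM hcM heM) Finset.card_le_three,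
      Finset.prod_empty, Finset.prod_singleton, Finset.prod_singleton, Finset.prod_singleton, Finset.prod_singleton,
      hp2 a b hab, hp2 a c hac, hp2 a e hae, hp2 b c hbc, hp2 b e hbe, hp2 c e hce,
      hp3 a b c hab hac hbc, hp3 a b e hab hae hbe, hp3 a c e hac hae hce, hp3 b c e hbc hbe hce]
    have hMD : ∀ d ∈ D, (a ∈ M ∨ a ∈ D) ∧ (b ∈ M ∨ b ∈ D) ∧ (c ∈ M ∨ c ∈ D) ∧ (e ∈ M ∨ e ∈ D) ∧ (d ∈ M ∨ d ∈ D) :=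
      fun d hd => ⟨Or.inl haM, Or.inl hbM, Or.inl hcM, Or.inl heM, Or.inr hd⟩
    rw [Finset.sum_congr rfl fun d hd => by
      obtain ⟨hA, hB, hC, hE, hDd⟩ := hMD d hd
      obtain ⟨-, -, hda, hdb, hdc, hde, -⟩ := hDm d hd
      rw [hT {d} _ (dS1 d hDd) (fun _ => ok1 d hd), hT {a, d} _ (dS2 a d hA hDd) (fun _ => okyd a haM d hd),
        hT {b, d} _ (dS2 b d hB hDd) (fun _ => okyd b hbM d hd), hT {c, d} _ (dS2 c d hC hDd) (fun _ => okyd c hcM d hd),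
        hT {e, d} _ (dS2 e d hE hDd) (fun _ => okyd e heM d hd),
        hT {a, b, d} _ (dS3 a b d hA hB hDd) (okab d hd), hT {a, c, d} _ (dS3 a c d hA hC hDd) (okac d hd),
        hT {a, e, d} _ (dS3 a e d hA hE hDd) (okae d hd), hT {b, c, d} _ (dS3 b c d hB hC hDd) (okbc d hd),
        hT {b, e, d} _ (dS3 b e d hB hE hDd) (okbe d hd), hT {c, e, d} _ (dS3 c e d hC hE hDd) (okce d hd),
        Finset.prod_singleton, hp2 a d (Ne.symm hda), hp2 b d (Ne.symm hdb), hp2 c d (Ne.symm hdc), hp2 e d (Ne.symm hde),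
        hp3 a b d hab (Ne.symm hda) (Ne.symm hdb), hp3 a c d hac (Ne.symm hda) (Ne.symm hdc),
        hp3 a e d hae (Ne.symm hda) (Ne.symm hde), hp3 b c d hbc (Ne.symm hdb) (Ne.symm hdc),
        hp3 b e d hbe (Ne.symm hdb) (Ne.symm hde), hp3 c e d hce (Ne.symm hdc) (Ne.symm hde)]]
    rw [Finset.sum_congr rfl fun d hd => Finset.sum_congr rfl fun d' hd' => by
      obtain ⟨hA, hB, hC, hE, hDd⟩ := hMD d hd
      obtain ⟨hne, hd'D⟩ := Finset.mem_erase.1 hd'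
      have hDd' : d' ∈ M ∨ d' ∈ D := Or.inr hd'D
      obtain ⟨-, -, hda, hdb, hdc, hde, -⟩ := hDm d hd
      obtain ⟨-, -, hda', hdb', hdc', hde', -⟩ := hDm d' hd'D
      rw [hT {d, d'} _ (dS2 d d' hDd hDd') (fun _ => okdd d hd d' hd'D (Ne.symm hne)),
        hT {a, d, d'} _ (dS3 a d d' hA hDd hDd') (ok2a d hd d' hd'), hT {b, d, d'} _ (dS3 b d d' hB hDd hDd') (ok2b d hd d' hd'),
        hT {e, d, d'} _ (dS3 e d d' hE hDd hDd') (ok2e d hd d' hd'),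
        hp2 d d' (Ne.symm hne), hp3 a d d' (Ne.symm hda) (Ne.symm hda') (Ne.symm hne),
        hp3 b d d' (Ne.symm hdb) (Ne.symm hdb') (Ne.symm hne), hp3 e d d' (Ne.symm hde) (Ne.symm hde') (Ne.symm hne)]]
    rw [Finset.sum_congr rfl fun d hd => Finset.sum_congr rfl fun d' hd' => Finset.sum_congr rfl fun d'' hd'' => by
      obtain ⟨hne, hd'D⟩ := Finset.mem_erase.1 hd'
      obtain ⟨hne', hd''1⟩ := Finset.mem_erase.1 hd''
      obtain ⟨hne'', hd''D⟩ := Finset.mem_erase.1 hd''1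
      rw [hT {d, d', d''} _ (dS3 d d' d'' (Or.inr hd) (Or.inr hd'D) (Or.inr hd''D)) (ok3 d hd d' hd' d'' hd''),
        hp3 d d' d'' (Ne.symm hne) (Ne.symm hne'') (Ne.symm hne')]]
    have hcolumn := chain₄_column w Z hab hac hae hbc hbe hce haZ hbZ hcZ heZ hZ haa hab₀ hac₀ hae₀ hbb hbc₀ hbe₀ hcc hca₀
      hce₀ hee hea₀ heb₀ hD D hDiff J (hcol kk) Y (fun u => rfl) Φ rfl
    rw [← ha₀, ← hb₀, ← hc₀, ← he₀] at hcolumn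
    exact hcolumn

end SecondShell

end

end Summit.ValiantsHypothesis.ValiantsHypothesis.Theorems.BarrierLever.HiddenStates
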